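import Summits.QuantumFields.BalabanUV.Beta.FP.ResidualModeAliasBound

/-!
# `BalabanUV.Beta.FP.ResidualModeSymbolUpper` — road «FP» (binder row D1), row H′2-IR ∕ IR-3 «IR-3-ELL-REAL», file 3: THE UPPER HALF
# **`m_{B,n}(k) ≤ 1`** ON THE PUNCTURED REAL ZONE (IR3-DESIGN (I4) `0 ⪯ M_B ⪯ 1` IN SYMBOLS) and the two-sided package `c₀(d) ≤ m_{B,n}(k) ≤ 1`

NOT IN PRINT; OUR BOOKKEEPING for the road-FP OWNER's IR-3-ELL (booked to this seat, journal l.22620).  Files 1∕2 (`ResidualModeSymbolBound`,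
`ResidualModeAliasBound`) gave the n-free LOWER bound `c₀(d) ≤ m_B`.  Here the UPPER bound, which the `−½ log det L_C` bookkeeping of
N7-PROOF v3.2 §3′ (E-FP-5-5) also consumes: the coarse covariance symbol dominates the RANK-ONE gauge form,
`Re v†Ĉ_n(k)v ≥ Mid(k)·|d̂^c(k)†v|²` for EVERY `v` (each alias term is at least its exact gauge share — (P2) in symbols, `gsum·d̂(q_a) = d̂^c(k)`),
whence by one Cauchy–Schwarz step in the `Ĉ⁻¹` inner product `Re d̂^c†Ĉ⁻¹d̂^c ≤ 1∕Mid`, i.e. `m_B = Mid·Re d̂^c†Ĉ⁻¹d̂^c ≤ 1`.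
Inputs BY NAME: file 1's `cMat`∕`midSym`∕`mB`, `quad_cMat`, `cMat_isHermitian`, `isUnit_cMat_det`, `gsum_mul_d1Sym_apt`, `d1Sym_wrapPt`,
`d1Sym_wrapPt_apt_ne_zero`, `cweight_eq_bweight_mul`, `midSym_pos`; `ResidualModeSymbols.re_quad_PinfSym_ge_gauge`; file 2's `mB_ge_const`.

## What is proved (`0 sorry`, every `d`, `n ≥ 1`, `k ∈ BZ (d+1)`, `k ≠ 0`)
* §1 [folklore] `re_quad_inv_le_of_gauge`: `IsUnit F.det`, `0 < m`, `m·‖u†w‖² ≤ Re w†Fw` for all `w` ⟹ `Re u†F⁻¹u ≤ 1∕m`.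
* §2 [our object] `star_d1Sym_dotProduct_weightVec_apply` (`d̂(q_a)†(conj cw(q_a) ∘ v) = conj(bw_a)·(d̂^c†v)` for every `v`),
  **`re_quad_cMat_ge_gauge`** (`midSym n k · ‖d̂^c(k)†v‖² ≤ Re v†Ĉ_n(k)v` — `Ĉ_n ⪰ Mid·d̂^c d̂^c†`).
* §3 [our object] **`mB_le_one`** (`mB n k ≤ 1`), `mB_pos` (`0 < mB n k`), **`mB_mem_Icc`** (`c₀(d) ≤ mB n k ≤ 1` with file 2's explicit n-free `c₀`),
  `exists_pos_le_mB_le_one` (packaged `∃ c₀ > 0, ∀ n k, c₀ ≤ m_B ≤ 1`).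
HONEST FRAMING: [our object] symbol inequalities for the cell's U = 1 perfect objects + [folklore] Cauchy–Schwarz; 0 estimates of Bałaban's manuscripts;
0∕4 row-D1 binders; NOT D1, NOT BetaPertH, NOT the continuum limit, NOT Clay.
HONEST DEPENDENCY (verbatim): «continuum YM on T⁴ ⇐ BetaPertH ∧ nine spine estimates (0/9 proved); BetaPertH ⇐ (D1) ∧ (D4) ∧ CAP+tail; G-an2-4 gates asym, D1 and NE2/3/4.»
ABSOLUTE RULE respected: no cited fact, no `def`, no `def … : Prop`, nothing of the manuscripts asserted.
Provenance: D1 formalisation swarm leaf prover 02, gen 7 (prover-b2b-balaban-beta-d1-formalise-leaf-02-g7-0), road-FP «IR-3-ELL-REAL» (journal l.22620 ∕ l.22783), 2026-08-20.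
-/

noncomputable section

open Complex Finset Matrix
open scoped Real BigOperators ComplexConjugate
open Literature.MathematicalPhysics.QuantumFieldTheory.Balaban1983to89
open B4Strip (ofRealVec)
open B4ContourShift (BZ)
open B5Prop11Fiber (d1Sym)
open Summit.QuantumFields.BalabanUV.Beta.GAN24.FibreSymbols (gsum)
open Summit.QuantumFields.BalabanUV.Beta.GAN24.AliasTiling (apt)
open Summit.QuantumFields.BalabanUV.Beta.GAN24.PushSumSymbol (cweight)
open Summit.QuantumFields.BalabanUV.Beta.FP.PerfectPropagatorSymbol (quad PinfSym quad_eq_dotProduct)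
open Summit.QuantumFields.BalabanUV.Beta.FP.CoarseCovarianceAliasBF (wrapPt wrapPt_mem_BZ)
open Summit.QuantumFields.BalabanUV.Beta.FP.ResidualModeSymbols (re_quad_PinfSym_ge_gauge)
open Summit.QuantumFields.BalabanUV.Beta.FP.ResidualModeSymbolBound (cMat bweight lapD midSym mB quad_cMat isUnit_cMat_det
  gsum_mul_d1Sym_apt d1Sym_wrapPt d1Sym_wrapPt_apt_ne_zero cweight_eq_bweight_mul midSym_pos)
open Summit.QuantumFields.BalabanUV.Beta.FP.ResidualModeAliasBound (mB_ge_const aEll_pos)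

namespace Summit.QuantumFields.BalabanUV.Beta.FP.ResidualModeSymbolUpper

variable {d : ℕ}

/-! ## §1 One Cauchy–Schwarz step in the `F⁻¹` inner product -/

/-- [folklore] **RANK-ONE DOMINATION INVERTS**: `F` invertible, `0 < m`, and `m·‖u†w‖² ≤ Re w†Fw` for every `w` (`F ⪰ m·uu†` in form currency)
⟹ `Re u†F⁻¹u ≤ 1∕m` (at `w := F⁻¹u`: `Re w†Fw = Re w†u = Re u†w =: r` and `‖u†w‖² ≥ r²`, so `m r² ≤ r`; no Hermitian symmetry needed). -/
theorem re_quad_inv_le_of_gauge {ι : ℕ} {F : Matrix (Fin ι) (Fin ι) ℂ} (hdet : IsUnit F.det) {m : ℝ} (hm : 0 < m)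
    (u : Fin ι → ℂ) (hgauge : ∀ w : Fin ι → ℂ, m * ‖star u ⬝ᵥ w‖ ^ 2 ≤ (star w ⬝ᵥ (F *ᵥ w)).re) :
    (quad F⁻¹ u).re ≤ 1 / m := by
  set w : Fin ι → ℂ := F⁻¹ *ᵥ u with hw
  have hFw : F *ᵥ w = u := by rw [hw, mulVec_mulVec, Matrix.mul_nonsing_inv _ hdet, one_mulVec]
  -- `r := Re u†F⁻¹u = Re u†w`
  have hr : (quad F⁻¹ u).re = (star u ⬝ᵥ w).re := by rw [quad_eq_dotProduct]
  -- `Re w†Fw = Re w†u = Re conj(u†w) = r`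
  have hwFw : (star w ⬝ᵥ (F *ᵥ w)).re = (star u ⬝ᵥ w).re := by
    rw [hFw, star_dotProduct, Complex.star_def, Complex.conj_re]
  have h := hgauge w
  rw [hwFw] at h
  rw [hr]
  set z : ℂ := star u ⬝ᵥ w with hz
  -- `‖z‖² ≥ (Re z)²`
  have hz2 : z.re ^ 2 ≤ ‖z‖ ^ 2 := by
    rw [Complex.sq_norm, Complex.normSq_apply]; nlinarith [sq_nonneg z.im]
  by_cases hrpos : 0 < z.re
  · rw [le_div_iff₀ hm]
    have h3 : m * z.re ^ 2 ≤ z.re := le_trans (mul_le_mul_of_nonneg_left hz2 hm.le) h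
    nlinarith
  · exact le_trans (not_lt.mp hrpos) (by positivity)

/-! ## §2 The coarse covariance symbol dominates the rank-one gauge form -/

section Gauge

variable (n : ℕ) [NeZero n] (k : Fin (d + 1) → ℝ)

/-- [our object] (P2) in form currency, for EVERY test vector: `d̂(q_a)†(λ ↦ conj(cw_λ(q_a))·v λ) = conj(bw_a)·(d̂^c(k)†v)`. -/
theorem star_d1Sym_dotProduct_weightVec_apply (a : Fin (d + 1) → Fin n) (v : Fin (d + 1) → ℂ) :
    star (d1Sym (wrapPt (apt n a k))) ⬝ᵥ (fun l => conj (cweight n l (ofRealVec (apt n a k))) * v l)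
      = conj (bweight n (ofRealVec (apt n a k))) * (star (d1Sym k) ⬝ᵥ v) := by
  rw [d1Sym_wrapPt, dotProduct, dotProduct, Finset.mul_sum]
  refine Finset.sum_congr rfl fun μ _ => ?_
  simp only [Pi.star_apply, RCLike.star_def]
  rw [cweight_eq_bweight_mul, map_mul, ← gsum_mul_d1Sym_apt n a k μ, map_mul]
  ring

/-- [our object] **`Ĉ_n(k) ⪰ Mid(k)·d̂^c(k) d̂^c(k)†`**: for `k ∈ BZ`, `k ≠ 0` and every `v`, `midSym n k · ‖d̂^c(k)†v‖² ≤ Re v†Ĉ_n(k)v`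
(every alias term is at least its gauge share `‖d̂(q_a)†u_a‖²∕Δ̂(q_a)²`, `ResidualModeSymbols.re_quad_PinfSym_ge_gauge`, and that share is exact). -/
theorem re_quad_cMat_ge_gauge {k : Fin (d + 1) → ℝ} (hk : k ∈ BZ (d + 1)) (hk0 : k ≠ 0) (v : Fin (d + 1) → ℂ) :
    midSym n k * ‖star (d1Sym k) ⬝ᵥ v‖ ^ 2 ≤ (quad (cMat n k) v).re := by
  rw [quad_cMat]
  have r2 : (((n : ℂ) ^ (d + 1))⁻¹) = ((((n : ℝ) ^ (d + 1))⁻¹ : ℝ) : ℂ) := by push_cast; ring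
  rw [r2, Complex.re_ofReal_mul, Complex.re_sum, midSym, mul_assoc, Finset.sum_mul]
  refine mul_le_mul_of_nonneg_left (Finset.sum_le_sum fun a _ => ?_) (by positivity)
  have hs'BZ : wrapPt (apt n a k) ∈ BZ (d + 1) := wrapPt_mem_BZ _
  have hph0 : d1Sym (wrapPt (apt n a k)) ≠ 0 := d1Sym_wrapPt_apt_ne_zero n hk hk0 a
  have h := re_quad_PinfSym_ge_gauge hs'BZ hph0 (fun l => conj (cweight n l (ofRealVec (apt n a k))) * v l)
  rw [star_d1Sym_dotProduct_weightVec_apply n k a v, norm_mul, Complex.norm_conj] at h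
  have hlap : ∑ β, ‖d1Sym (wrapPt (apt n a k)) β‖ ^ 2 = lapD (apt n a k) := by rw [d1Sym_wrapPt]; rfl
  rw [hlap] at h
  calc ‖bweight n (ofRealVec (apt n a k))‖ ^ 2 / lapD (apt n a k) ^ 2 * ‖star (d1Sym k) ⬝ᵥ v‖ ^ 2
      = (‖bweight n (ofRealVec (apt n a k))‖ * ‖star (d1Sym k) ⬝ᵥ v‖) ^ 2 / lapD (apt n a k) ^ 2 := by ring
    _ ≤ _ := h

end Gauge

/-! ## §3 `m_B ≤ 1` and the two-sided package -/

/-- [our object] **`m_{B,n}(k) ≤ 1`** on the punctured real zone, every `n ≥ 1`, every `d` (IR3-DESIGN (I4) `M_B ⪯ 1` in symbols). -/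
theorem mB_le_one (n : ℕ) [NeZero n] {k : Fin (d + 1) → ℝ} (hk : k ∈ BZ (d + 1)) (hk0 : k ≠ 0) : mB n k ≤ 1 := by
  have hm := midSym_pos n hk hk0
  have h := re_quad_inv_le_of_gauge (isUnit_cMat_det n hk hk0) hm (d1Sym k)
    (fun w => by
      have h1 := re_quad_cMat_ge_gauge n hk hk0 w
      rwa [quad_eq_dotProduct] at h1)
  unfold mB
  calc midSym n k * (quad (cMat n k)⁻¹ (d1Sym k)).re ≤ midSym n k * (1 / midSym n k) := mul_le_mul_of_nonneg_left h hm.le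
    _ = 1 := by field_simp

/-- [our object] `0 < m_{B,n}(k)` on the punctured real zone. -/
theorem mB_pos (n : ℕ) [NeZero n] {k : Fin (d + 1) → ℝ} (hk : k ∈ BZ (d + 1)) (hk0 : k ≠ 0) : 0 < mB n k :=
  lt_of_lt_of_le (div_pos (by positivity) (aEll_pos d)) (mB_ge_const n hk hk0)

/-- [our object] **THE TWO-SIDED SANDWICH** `c₀(d) ≤ m_{B,n}(k) ≤ 1`, `c₀(d) = (4∕π²)^{d+3} ∕ aEll d` explicit and n-FREE. -/
theorem mB_mem_Icc (n : ℕ) [NeZero n] {k : Fin (d + 1) → ℝ} (hk : k ∈ BZ (d + 1)) (hk0 : k ≠ 0) :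
    mB n k ∈ Set.Icc ((4 / Real.pi ^ 2) ^ (d + 1 + 2)
      / (Real.pi ^ 2 / 4 + ((d : ℝ) + 1) * ((5 : ℝ) ^ (d + 1) - 1) * (Real.pi ^ 4 / 16) * (Real.pi / 2) ^ (2 * (d + 1)))) 1 :=
  ⟨mB_ge_const n hk hk0, mB_le_one n hk hk0⟩

/-- [our object] PACKAGED: one n-free `c₀ > 0` with `c₀ ≤ m_{B,n}(k) ≤ 1` for every `n ≥ 1` and every `k ∈ BZ ∖ {0}`. -/
theorem exists_pos_le_mB_le_one (d : ℕ) :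
    ∃ c₀ : ℝ, 0 < c₀ ∧ ∀ (n : ℕ) [NeZero n] (k : Fin (d + 1) → ℝ), k ∈ BZ (d + 1) → k ≠ 0 → c₀ ≤ mB n k ∧ mB n k ≤ 1 :=
  ⟨_, div_pos (by positivity) (aEll_pos d), fun n _ _ hk hk0 => ⟨mB_ge_const n hk hk0, mB_le_one n hk hk0⟩⟩

end Summit.QuantumFields.BalabanUV.Beta.FP.ResidualModeSymbolUpper

end
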